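import Mathlib.AlgebraicTopology.FundamentalGroupoid.SimplyConnected
import Literature.Geometry.Lorentzian.KillingHorizonShadowAlong
import Literature.Geometry.Lorentzian.IPlusRegular
import Literature.Geometry.Lorentzian.Einstein
import HarnessLib

/-!
# Surface gravity of the event horizon of an `I⁺`-regular vacuum black hole: the zeroth law and
# the near-horizon Gauss–Bonnet obstruction to a Killing–causal collar around a degenerate horizon

Two NAMED FACTS (D-0014) in consequence form, about a Killing field `K` given on a neighbourhood
of the event horizon `𝓔⁺` of an `I⁺`-regular vacuum `StationaryAFBlackHole` which is null,
nowhere zero and (locally) tangent on `𝓔⁺` — i.e. `𝓔⁺` is a Killing horizon of `K`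
(Chruściel–Costa 2008 Thm 4.11 makes `𝓔⁺` a smooth null hypersurface; Wald 1984 §12.5):

* `VacuumHorizonZerothLaw` — `∇_K K = κ K` on the connected `𝓔⁺` with ONE constant `κ` (the
  zeroth law of black-hole mechanics, Bardeen–Carter–Hawking 1973; Wald 1984 (12.5.24)–(12.5.31)).
* `DegenerateVacuumHorizonNoCollar` — if moreover `κ = 0` (degenerate horizon) and the d.o.c. is
  simply connected (spherical cross-sections), then `K` is spacelike at points of `⟨⟨M_ext⟩⟩`
  arbitrarily close to `𝓔⁺`: a three-line consequence (spelled out in the docstring) of the vacuum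
  near-horizon equations in Gaussian null coordinates (Kunduri–Lucietti 2013 (7), (17)–(18);
  Chruściel–Reall–Tod 2006) and of the Gauss–Bonnet identity `χ(H) = (1/4π)∫_H R_γ`
  (Kunduri–Lucietti 2013, proof of Thm 3.1): `∫_H F = 4πχ(H) = 8π > 0`.

The tree has no Gaussian null coordinates, no null-hypersurface calculus and no Gauss–Bonnet
theorem, whence the consequence form in the vocabulary of `Stationary.lean` /
`KillingHorizonShadowAlong.lean` (`IsKillingFieldOn`, `leviCivita`, `val`, `IsMIntegralCurveOn`).
Users take the facts as hypotheses; requested by the line lead of crux stmt-FinalStateConjecture-17840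
(`ZeroEnergyKerrOrBomb.HawkingExtensionIsKerr`), whose registered skeleton derives from them that a
Killing–TIMELIKE collar has non-zero surface gravity (`collarSurfaceGravity_of`).

## References

* J. M. Bardeen, B. Carter, S. W. Hawking, Commun. Math. Phys. 31 (1973) 161–170, §3
  (key `BardeenCarterHawking1973`).
* R. M. Wald, *General Relativity* (1984), §12.5, (12.5.2)–(12.5.5), (12.5.24)–(12.5.31)
  (key `Wald1984`).
* P. T. Chruściel, J. L. Costa, Astérisque 321 (2008) = arXiv:0806.0016, §2.3 (2.8), §4.1–4.3,
  Thm. 4.11 (key `ChruscielCosta2008`).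
* H. K. Kunduri, J. Lucietti, Living Rev. Relativity 16 (2013) 8 = arXiv:1306.2517, §2.1 (7),
  (17)–(18), Thm. 3.1 (key `KunduriLucietti2013`).
* P. T. Chruściel, H. S. Reall, P. Tod, Class. Quantum Grav. 23 (2006) 549–554 = gr-qc/0512041,
  (1)–(3), (vEe), (Asol) (key `ChruscielReallTod2006`).
-/

noncomputable section

open scoped Manifold ContDiff

namespace Literature.Geometry.Lorentzian

open Set Function

/-- **Zeroth law of black-hole mechanics for the event horizon of an `I⁺`-regular vacuum hole,
consequence form (named fact, D-0014).**  Printed ingredients: (1) Chruściel–Costa 2008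
(arXiv:0806.0016), Thm 4.11: in an `I⁺`-regular space-time (stationary Killing vector complete,
`⟨⟨M_ext⟩⟩` globally hyperbolic, null energy condition — here vacuum — and the hypersurface `𝒮` of
Def. 1.1 whose boundary is a compact cross-section `S ⊂ 𝓔⁺`) the event horizon
`∪_t φ_t[K₀](S) = 𝓔⁺` is a SMOOTH null hypersurface (§4.1–4.3); (2) a Killing field `K` defined
near a smooth null hypersurface `𝓝`, null, nowhere zero and tangent on `𝓝`, is its null normal, so
`𝓝` is a Killing horizon of `K` and `∇_K K = κ K` on `𝓝` for a function `κ`, the surface gravity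
(Wald 1984, §12.5, (12.5.2)–(12.5.5); Chruściel–Costa 2008 §2.3, (2.8)); (3) the zeroth law: in
vacuum (indeed under the dominant energy condition) `κ` is constant on each connected component
of a Killing horizon (Bardeen–Carter–Hawking, Commun. Math. Phys. 31 (1973) 161, §3; Wald 1984,
§12.5, (12.5.24)–(12.5.31): "which states that κ is constant on the horizon").
Vendored, hypothesis by hypothesis, in the tree's vocabulary: for a vacuum `I⁺`-regular
`StationaryAFBlackHole` with CONNECTED horizon `𝓔⁺ = 𝓑.horizon`, and a Killing field `K` on an
open `U ⊇ 𝓔⁺` (`IsKillingFieldOn`) commuting with `T` there (EXTRA), nowhere zero and NULL on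
`𝓔⁺`, and TANGENT to `𝓔⁺` in the local form "through every `p ∈ 𝓔⁺` some integral curve of `K`
on a short open interval stays in `𝓔⁺`": there is ONE constant `κ` with `∇_K K = κ K` on `𝓔⁺`.
(Non-degeneracy `κ ≠ 0` is NOT asserted.)
[cite: ChruscielCosta2008, Thm. 4.11 (§4.3) with §4.1 and §2.3 (2.8)]
[cite: Wald1984, §12.5, (12.5.2)–(12.5.5) and (12.5.24)–(12.5.31)]
[cite: BardeenCarterHawking1973, §3 (zeroth law)]
-/
def VacuumHorizonZerothLaw : Prop :=
  ∀ (𝓑 : StationaryAFBlackHole.{0}) [𝓑.metric.HasLeviCivita],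
    𝓑.metric.toPseudoRiemannianMetric.IsRicciFlat → 𝓑.IsIPlusRegular → IsConnected 𝓑.horizon →
    ∀ (U : Set 𝓑.carrier) (K : Π x : 𝓑.carrier, TangentSpace (𝓡 4) x),
      IsOpen U → 𝓑.horizon ⊆ U → 𝓑.metric.toPseudoRiemannianMetric.IsKillingFieldOn K U →
      (∀ x ∈ U, VectorField.mlieBracket (𝓡 4) 𝓑.killing K x = 0) →
      (∀ p ∈ 𝓑.horizon, K p ≠ 0) →
      (∀ p ∈ 𝓑.horizon, 𝓑.metric.val p (K p) (K p) = 0) →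
      (∀ p ∈ 𝓑.horizon, ∃ ε > (0 : ℝ), ∃ γ : ℝ → 𝓑.carrier, γ 0 = p ∧
        IsMIntegralCurveOn γ K (Set.Ioo (-ε) ε) ∧ ∀ t ∈ Set.Ioo (-ε) ε, γ t ∈ 𝓑.horizon) →
      ∃ κ : ℝ, ∀ p ∈ 𝓑.horizon, 𝓑.metric.leviCivita K p (K p) = κ • K p

/-- **Degenerate vacuum Killing horizons with spherical sections have no Killing–causal collar
(near-horizon Gauss–Bonnet; named fact in consequence form, D-0014).**  Printed ingredients:
(1) as in `VacuumHorizonZerothLaw`, `𝓔⁺` is a smooth Killing horizon of `K` (Chruściel–Costa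
2008 Thm 4.11; Wald 1984 §12.5), here DEGENERATE (`∇_K K = 0` on `𝓔⁺`), with compact
cross-sections which are spheres (Chruściel–Costa 2008, §4.1 and the Corollary "`S` is a
two-dimensional sphere" of §2.4/§4 for four-dimensional `I⁺`-regular holes with simply connected
`⟨⟨M_ext⟩⟩`; Chruściel–Wald, Class. Quantum Grav. 11 (1994) L147); (2) Gaussian null coordinates at
a degenerate Killing horizon, `g = r² F dv² + 2 dv dr + 2 r h_a dv dxᵃ + γ_ab dxᵃ dxᵇ`, `K = ∂_v`,
`g(K, K) = r² F` (Kunduri–Lucietti, Living Rev. Relativity 16 (2013) 8, §2.1 (7) and §2.2;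
Chruściel–Reall–Tod, Class. Quantum Grav. 23 (2006) 549, (1)–(3): "our analysis applies to any
degenerate Killing horizon (not necessarily static)"); (3) the VACUUM near-horizon equations on a
cross-section `H`: `R_ab[γ] = ½ h_a h_b − ∇_(a h_b)`, `F = ½ hᵃ h_a − ½ ∇_a hᵃ` (Kunduri–Lucietti
2013, (17)–(18) with `Λ = 0`, `T = 0`; Chruściel–Reall–Tod 2006, (vEe), (Asol)); (4) the identity
`χ(H) = (1/4π) ∫_H R_γ = (1/8π) ∫_H h·h` obtained by integrating the trace of (3) (Kunduri–Lucietti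
2013, proof of Thm 3.1).  CONSEQUENCE (three lines, recorded here because no verbatim locator is
known to the vendor): integrating `F` over `H` with (3)–(4), `∫_H F = ½ ∫_H h·h = 4π χ(H) = 8π > 0`
for `H ≅ S²`, so `F > 0` on a non-empty open subset of `H`, where `g(K, K) = r² F + O(r³) > 0` for
all small `r ≠ 0`: the generator Killing field is SPACELIKE at points of `⟨⟨M_ext⟩⟩` arbitrarily
close to `𝓔⁺`.  Vendored statement: for a vacuum `I⁺`-regular `StationaryAFBlackHole` with connected
horizon and simply connected d.o.c., and `K` Killing on an open `U ⊇ 𝓔⁺` commuting with `T` (EXTRA),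
nowhere zero, null and locally tangent on `𝓔⁺` as in `VacuumHorizonZerothLaw`, with `∇_K K = 0` on
`𝓔⁺`: every open `V ⊇ 𝓔⁺` contains a point of `⟨⟨M_ext⟩⟩` at which `K` is spacelike.  (On the
extreme Kerr horizon `F > 0` exactly on the band `sin θ > √3 − 1`: Bardeen–Horowitz 1999, (2.6)ff.)
[cite: KunduriLucietti2013, §2.1 (7), (17)–(18), Thm. 3.1 (proof)]
[cite: ChruscielReallTod2006, (1)–(3), (vEe), (Asol)]
[cite: ChruscielCosta2008, Thm. 4.11, §4.1, Cor. (Cst)]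
-/
def DegenerateVacuumHorizonNoCollar : Prop :=
  ∀ (𝓑 : StationaryAFBlackHole.{0}) [𝓑.metric.HasLeviCivita],
    𝓑.metric.toPseudoRiemannianMetric.IsRicciFlat → 𝓑.IsIPlusRegular → IsConnected 𝓑.horizon →
    SimplyConnectedSpace 𝓑.doc →
    ∀ (U : Set 𝓑.carrier) (K : Π x : 𝓑.carrier, TangentSpace (𝓡 4) x),
      IsOpen U → 𝓑.horizon ⊆ U → 𝓑.metric.toPseudoRiemannianMetric.IsKillingFieldOn K U →
      (∀ x ∈ U, VectorField.mlieBracket (𝓡 4) 𝓑.killing K x = 0) →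
      (∀ p ∈ 𝓑.horizon, K p ≠ 0) →
      (∀ p ∈ 𝓑.horizon, 𝓑.metric.val p (K p) (K p) = 0) →
      (∀ p ∈ 𝓑.horizon, ∃ ε > (0 : ℝ), ∃ γ : ℝ → 𝓑.carrier, γ 0 = p ∧
        IsMIntegralCurveOn γ K (Set.Ioo (-ε) ε) ∧ ∀ t ∈ Set.Ioo (-ε) ε, γ t ∈ 𝓑.horizon) →
      (∀ p ∈ 𝓑.horizon, 𝓑.metric.leviCivita K p (K p) = 0) →
      ∀ V : Set 𝓑.carrier, IsOpen V → 𝓑.horizon ⊆ V →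
        ∃ x ∈ V ∩ 𝓑.doc, 0 < 𝓑.metric.val x (K x) (K x)


/-- Hypothesis form of `VacuumHorizonZerothLaw`: tautological unfolding.  Wald 1984, §12.5.
[cite: Wald1984, §12.5, (12.5.31)] -/
theorem VacuumHorizonZerothLaw.apply (h : VacuumHorizonZerothLaw) (𝓑 : StationaryAFBlackHole.{0})
    [𝓑.metric.HasLeviCivita] (hvac : 𝓑.metric.toPseudoRiemannianMetric.IsRicciFlat)
    (hreg : 𝓑.IsIPlusRegular) (hconn : IsConnected 𝓑.horizon) {U : Set 𝓑.carrier}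
    {K : Π x : 𝓑.carrier, TangentSpace (𝓡 4) x} (hU : IsOpen U) (hHU : 𝓑.horizon ⊆ U)
    (hK : 𝓑.metric.toPseudoRiemannianMetric.IsKillingFieldOn K U)
    (hTK : ∀ x ∈ U, VectorField.mlieBracket (𝓡 4) 𝓑.killing K x = 0)
    (hne : ∀ p ∈ 𝓑.horizon, K p ≠ 0) (hnull : ∀ p ∈ 𝓑.horizon, 𝓑.metric.val p (K p) (K p) = 0)
    (htan : ∀ p ∈ 𝓑.horizon, ∃ ε > (0 : ℝ), ∃ γ : ℝ → 𝓑.carrier, γ 0 = p ∧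
      IsMIntegralCurveOn γ K (Set.Ioo (-ε) ε) ∧ ∀ t ∈ Set.Ioo (-ε) ε, γ t ∈ 𝓑.horizon) :
    ∃ κ : ℝ, ∀ p ∈ 𝓑.horizon, 𝓑.metric.leviCivita K p (K p) = κ • K p :=
  h 𝓑 hvac hreg hconn U K hU hHU hK hTK hne hnull htan

end Literature.Geometry.Lorentzian

end
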